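import Literature.AlgebraicGeometry.Resolution.GeneralizedStabilityRankOneVTSteps
import Mathlib.GroupTheory.Sylow
import Mathlib.Data.Nat.Factorization.Basic
import HarnessLib

/-!
# Generalized stability for `K(x)^h` without the Lemma of Ostrowski, II: the Galois case through all Sylow subgroups (Kuhlmann 2010, §5)

Topic: `Literature/AlgebraicGeometry/Resolution` (valued function fields). Second of three files
re-assembling `Kuhlmann2010StabilityHenselizedRationalValueTranscendental`
(`GeneralizedStabilityRankOneVT.lean` = F.-V. Kuhlmann, *Elimination of ramification I*, Trans.
AMS 362 (2010) = arXiv:1003.5678, §5, proof of (R4), pp. 18–20) from the italicized statement of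
§5 ALONE (`Kuhlmann2010HenselizedRationalImmediateExt`), without the Lemma of Ostrowski. The
printed induction (p. 20),

> The proof that `E.N|N` is defectless now proceeds by induction on the number of extensions
> appearing in the tower. … there is a normal subextension `E'|N` of `E.N|N` of degree `p`. By
> Corollary 4.2 or Proposition 3.1, this extension is defectless. From the preceding lemma we
> infer that `E'` is again a henselized inertially generated function field of rank 1 … By
> induction hypothesis, `(E|E',v)` is also defectless since it has a smaller degree than `E|N`.
> Hence by Lemma 2.13, `(E|N,v)` is defectless.

is run here, for a finite GALOIS extension `E|M` of a `K(x')^h`-field `M` with group `G` of order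
`n`, separately inside EVERY Sylow subgroup: for a prime `q` and a `q`-Sylow subgroup `Q`, the
fixed field `T = E^Q` is again a `K(x'')^h`-field (Lemma 5.5) and `E|T` is a tower of Galois
steps of degree `q` through such fields (a central subgroup of order `q` at each stage), each
defectless by `IsHenselizedRationalVT.isDefectlessPair_of_isGalois_prime`
(`GeneralizedStabilityRankOneVTSteps.lean`); so `E|T` is defectless with `f = 1`, i.e.
`(vE : vT) = |Q| = q^{v_q(n)}`, whence `q^{v_q(n)}` divides `(vE : vM) = (vT : vM)(vE : vT)`. This
for all `q` gives `n ∣ (vE : vM) ≤ n` (fundamental inequality, `f = 1`): `(vE : vM) = n = [E : M]`,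
and `E|M` is defectless — with no appeal to Ostrowski's lemma for the steps of degree prime
to `p`.

## Content (everything PROVED)

* `isDefectlessPair_of_isGalois_primePow` — Galois extensions of prime-power degree `q^s` of
  `K(x')^h`-fields are defectless (induction on `s` through a central subgroup of order `q`).
* `isDefectlessPair_of_isGalois'` — **finite Galois extensions of `K(x')^h`-fields are
  defectless**, from `Kuhlmann2010HenselizedRationalImmediateExt` alone.

## Sources

* F.-V. Kuhlmann, *Elimination of ramification I: The generalized stability theorem*, Trans.
  Amer. Math. Soc. 362 (2010) 5697–5727 = arXiv:1003.5678: §2.3 (Lemma 2.13), §5 (proof of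
  (R4), pp. 19–20; Lemma 5.5).
* Finite group theory (Sylow subgroups and their cardinality `q^{v_q(|G|)}`, non-trivial centre
  of `q`-groups) is Mathlib's (`Sylow.card_eq_multiplicity`, `IsPGroup.center_nontrivial`).

## Rendering notes

* The passage through all Sylow subgroups (instead of the `p`-Sylow subgroup and Ostrowski's
  lemma for its fixed field, `GeneralizedStabilityRankOneVTGalois.lean`) is a routine variant of
  the printed argument, available because `f = 1` over the base fields `K(x')^h`; tagged
  `[folklore]` where it deviates from print.
-/

noncomputable section

open IsLocalRing

namespace Literature.AlgebraicGeometry.Resolution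

universe u

section Galois

variable {Ω : Type u} [Field Ω] [IsAlgClosed Ω] {V : ValuationSubring Ω} {K : Subfield Ω}

/-- **Galois extensions of prime-power degree `q^s` of `K(x')^h`-fields are defectless** (the
induction of p. 20 inside a `q`-group): a central subgroup `C` of order `q` of the Galois group
cuts `E|M` into the Galois extension `E^C|M` of degree `q^{s-1}` (induction; `E^C` is again a
`K(x'')^h`-field by Lemma 5.5) and the Galois step `E|E^C` of degree `q`, defectless by
`IsHenselizedRationalVT.isDefectlessPair_of_isGalois_prime`; Lemma 2.13 reassembles. PROVED from
`Kuhlmann2010HenselizedRationalImmediateExt` alone.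
[cite: Kuhlmann2010, Section 5, proof of Thm. 1.1 (pp. 19–20)] -/
theorem isDefectlessPair_of_isGalois_primePow (hM : Kuhlmann2010HenselizedRationalImmediateExt.{u})
    (hK : IsAlgClosed K) {q : ℕ} (hq : q.Prime) (s : ℕ) :
    ∀ (M E : Subfield Ω) (h : M ≤ E), IsHenselizedRationalVT V K M → RelFinite M E h →
      (letI : Algebra M E := (Subfield.inclusion h).toAlgebra; IsGalois M E) →
      relFinrank M E h = q ^ s → IsDefectlessPair V M E h := by
  classical
  induction s with
  | zero =>
    intro M E h _ hfin _ hn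
    rw [pow_zero] at hn
    exact isDefectlessPair_of_relFinrank_eq_one h hfin hn
  | succ s ih =>
    intro M E h hMcl hfin hgal hn
    letI : Algebra M E := (Subfield.inclusion h).toAlgebra
    haveI : IsScalarTower M E Ω := IsScalarTower.of_algebraMap_eq fun _ => rfl
    haveI : FiniteDimensional M E := hfin
    haveI : IsGalois M E := hgal
    haveI : Fact q.Prime := ⟨hq⟩
    have hcard : Nat.card (E ≃ₐ[M] E) = q ^ (s + 1) := by
      rw [IsGalois.card_aut_eq_finrank]; exact hn
    have hG : IsPGroup q (E ≃ₐ[M] E) := IsPGroup.of_card hcard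
    haveI : Nontrivial (E ≃ₐ[M] E) := Finite.one_lt_card_iff_nontrivial.mp (by
      rw [hcard]
      exact Nat.one_lt_pow (Nat.succ_ne_zero s) hq.one_lt)
    haveI := IsPGroup.center_nontrivial hG
    -- a central subgroup `C` of order `q`
    have hZ : q ∣ Nat.card (Subgroup.center (E ≃ₐ[M] E)) := by
      rcases (hG.to_subgroup (Subgroup.center _)).card_eq_or_dvd with h1 | h1
      · exact absurd h1 (Finite.one_lt_card_iff_nontrivial.mpr inferInstance).ne'
      · exact h1
    obtain ⟨z, hz⟩ := exists_prime_orderOf_dvd_card' q hZ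
    let g : E ≃ₐ[M] E := z
    have hg : orderOf g = q := by rw [Subgroup.orderOf_coe]; exact hz
    have hgZ : g ∈ Subgroup.center (E ≃ₐ[M] E) := z.2
    let C : Subgroup (E ≃ₐ[M] E) := Subgroup.zpowers g
    haveI hCn : C.Normal := by
      refine ⟨fun a ha b => ?_⟩
      have haZ : a ∈ Subgroup.center (E ≃ₐ[M] E) := (Subgroup.zpowers_le.mpr hgZ) ha
      have : b * a * b⁻¹ = a := by
        rw [Subgroup.mem_center_iff.mp haZ b, mul_inv_cancel_right]
      rw [this]; exact ha
    have hCcard : Nat.card C = q := by rw [Nat.card_zpowers]; exact hg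
    -- its fixed field `N`: `N|M` Galois of degree `q^s`, `E|N` Galois of degree `q`
    let S : IntermediateField M E := IntermediateField.fixedField C
    haveI : IsGalois M S := IsGalois.of_fixedField_normal_subgroup C
    let N : Subfield Ω := liftSubfield S
    have hMN : M ≤ N := le_liftSubfield S
    have hNE : N ≤ E := liftSubfield_le S
    have hNEdeg : relFinrank N E hNE = q := by
      rw [relFinrank_liftSubfield_eq, IntermediateField.finrank_fixedField_eq_card, hCcard]
    have hfinNE : RelFinite N E hNE := relFinite_liftSubfield S
    have hfinMN : RelFinite M N hMN := relFinite_liftSubfield_bot S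
    have hgalMN := isGalois_liftSubfield_bot (M := M) (E := E) S
    have hgalNE := isGalois_liftSubfield_top (M := M) (E := E) S
    have hMNdeg : relFinrank M N hMN = q ^ s := by
      have ht := (rel_tower (V := V) hMN hNE).2.2
      rw [hNEdeg] at ht
      have : relFinrank M E (hMN.trans hNE) = q ^ (s + 1) := hn
      rw [this, pow_succ] at ht
      exact (Nat.eq_of_mul_eq_mul_right hq.pos ht).symm
    have hdMN : IsDefectlessPair V M N hMN := ih M N hMN hMcl hfinMN hgalMN hMNdeg
    have hN : IsHenselizedRationalVT V K N := hMcl.of_relFinite' hM hK hMN hfinMN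
    have hdNE : IsDefectlessPair V N E hNE :=
      hN.isDefectlessPair_of_isGalois_prime hM hK hNE hfinNE hgalNE hq hNEdeg
    exact (isDefectlessPair_tower_iff hMN hNE hfin).mpr ⟨hdMN, hdNE⟩

/-- **Finite Galois extensions of `K(x')^h`-fields are defectless, without the Lemma of
Ostrowski**: for `E|M` Galois with group `G` of order `n` and every prime `q`, the fixed field `T`
of a `q`-Sylow subgroup is a `K(x'')^h`-field (Lemma 5.5), `E|T` is Galois of degree
`q^{v_q(n)}` and defectless (`isDefectlessPair_of_isGalois_primePow`) with `f(E|T) = 1`, so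
`q^{v_q(n)} = (vE : vT)` divides `(vE : vM)`; hence `n ∣ (vE : vM) ≤ n` and, `f(E|M)` being `1`,
`[E : M] = (vE : vM)[Ev : Mv]`. PROVED from `Kuhlmann2010HenselizedRationalImmediateExt` alone.
[cite: Kuhlmann2010, Section 5, proof of Thm. 1.1 (pp. 19–20)] -/
theorem isDefectlessPair_of_isGalois' (hM : Kuhlmann2010HenselizedRationalImmediateExt.{u})
    (hK : IsAlgClosed K) {M E : Subfield Ω} (h : M ≤ E) (hMcl : IsHenselizedRationalVT V K M)
    (hfin : RelFinite M E h)
    (hgal : letI : Algebra M E := (Subfield.inclusion h).toAlgebra; IsGalois M E) :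
    IsDefectlessPair V M E h := by
  classical
  letI : Algebra M E := (Subfield.inclusion h).toAlgebra
  haveI : IsScalarTower M E Ω := IsScalarTower.of_algebraMap_eq fun _ => rfl
  haveI : FiniteDimensional M E := hfin
  haveI : IsGalois M E := hgal
  set n := relFinrank M E h with hndef
  have hn1 : 1 ≤ n := one_le_relFinrank h hfin
  have hcard : Nat.card (E ≃ₐ[M] E) = n := by rw [IsGalois.card_aut_eq_finrank]; rfl
  have hf : relInertiaDegree V M E h = 1 :=
    relInertiaDegree_eq_one_of_resField_le hK hMcl.le hMcl.resField_le h hfin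
  set e := relRamificationIndex V M E h with hedef
  have he1 : 1 ≤ e := (one_le_relRamificationIndex_and_relInertiaDegree (V := V) h hfin).1
  have hele : e ≤ n := by
    have := relRamificationIndex_mul_relInertiaDegree_le (V := V) h hfin
    rw [hf, mul_one] at this
    exact this
  -- `n ∣ e`: for every prime `q`, `q^{v_q(n)} ∣ e`
  have hdvd : n ∣ e := by
    refine (Nat.factorization_le_iff_dvd (by omega) (by omega)).mp (Finsupp.le_def.mpr fun q => ?_)
    by_cases hq : q.Prime
    swap
    · rw [Nat.factorization_eq_zero_of_not_prime n hq]; exact Nat.zero_le _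
    haveI : Fact q.Prime := ⟨hq⟩
    obtain ⟨Q⟩ : Nonempty (Sylow q (E ≃ₐ[M] E)) := inferInstance
    have hQcard : Nat.card Q = q ^ n.factorization q := by rw [Sylow.card_eq_multiplicity, hcard]
    -- the fixed field `T` of `Q`
    let S : IntermediateField M E := IntermediateField.fixedField (Q : Subgroup (E ≃ₐ[M] E))
    let T : Subfield Ω := liftSubfield S
    have hMT : M ≤ T := le_liftSubfield S
    have hTE : T ≤ E := liftSubfield_le S
    have hTEdeg : relFinrank T E hTE = q ^ n.factorization q := by
      rw [relFinrank_liftSubfield_eq, IntermediateField.finrank_fixedField_eq_card, hQcard]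
    have hfinTE : RelFinite T E hTE := relFinite_liftSubfield S
    have hfinMT : RelFinite M T hMT := relFinite_liftSubfield_bot S
    have hgalTE := isGalois_liftSubfield_top (M := M) (E := E) S
    have hT : IsHenselizedRationalVT V K T := hMcl.of_relFinite' hM hK hMT hfinMT
    have hdTE : IsDefectlessPair V T E hTE :=
      isDefectlessPair_of_isGalois_primePow hM hK hq _ T E hTE hT hfinTE hgalTE hTEdeg
    have hfTE : relInertiaDegree V T E hTE = 1 :=
      relInertiaDegree_eq_one_of_resField_le hK hT.le hT.resField_le hTE hfinTE
    have heTE : relRamificationIndex V T E hTE = q ^ n.factorization q := by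
      unfold IsDefectlessPair at hdTE
      rw [hfTE, mul_one, hTEdeg] at hdTE
      exact hdTE
    -- `e(E|M) = e(T|M) e(E|T)`
    have htower : e = relRamificationIndex V M T hMT * q ^ n.factorization q := by
      rw [← heTE]
      exact (rel_tower (V := V) hMT hTE).1
    have hqdvd : q ^ n.factorization q ∣ e := ⟨relRamificationIndex V M T hMT, by rw [htower, mul_comm]⟩
    exact (hq.pow_dvd_iff_le_factorization (by omega)).mp hqdvd
  have heq : e = n := le_antisymm hele (Nat.le_of_dvd (by omega) hdvd)
  unfold IsDefectlessPair
  rw [hf, mul_one]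
  exact heq

end Galois

end Literature.AlgebraicGeometry.Resolution
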